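import Literature.MathematicalPhysics.QuantumFieldTheory.Balaban1983to89.T4Crossover

/-!
# CauchySumCrossoverThreshold — the (β)-reading surrogate of T4-DAG §8 Q43 (c): two-sided crossover bound and the EXACT
# summability threshold `p·σ > 1`, `σ = log(1∕a)∕log(Λ∕a)` (= `β∕(4+β)` at `a = L^{−β}`, `Λ = L⁴`)
(cell `pub-balaban`, T4-DAG row `T4-U6.R-QCALC2°`, ruling §8 Q43 (c)∕(d2)∕(d4)(3); the (β)-side companion of `T4Crossover` §2
and a sibling of `Support/CauchySumSummableShift{,Socket}` ∕ `Support/CauchySumPinnedConvolution`)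

HONEST FRAMING (cell `pub-balaban`, page 1).  Rung (B)+1 of the FINITE-VOLUME T⁴ programme — NOT infinite volume, NOT a
mass gap, NOT the Clay problem; spine PROVED 0∕9.  ELEMENTARY REAL ANALYSIS on the T4-DAG WRITER'S SURROGATE for the naive
crossover reading (β) of the coupling channel — the finite sums `Σ_{n<N} min(a^n, M·Λ^n)` and `Σ_{n<N} min(a^n, n·M·Λ^n)`
(`a` = irrelevance contraction and `Λ` = multiplicity growth per remaining scale, `M` = size of the synchronised scale shift
on the recent window); it asserts NOTHING about Bałaban's renormalization-group objects, is NOT a statement about the kernel's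
`T4CauchySum.delta` ∕ `T4Crossover.crossoverDelta`, and is NOT an estimate of any NE row.  HONEST DEPENDENCY: continuum YM
on T⁴ ⇐ BetaPertH ∧ nine spine estimates (0/9 proved); BetaPertH ⇐ (D1) ∧ (D4) ∧ CAP+tail; G-an2-4 gates asym, D1 and NE2/3/4.

CONTEXT (T4-DAG §8 Q43 (c), the writer's words, for context only): «WRITER'S ARITHMETIC on the shape Σ_n min(a^n, n·M_K·Λ^n)
with M_K := sup_{i≥K∕2} shift_i, NOT a census fact, offered to calc-grammar as a v5 surrogate check — degrades δ_K to order
M_K^{log(1∕a)∕log(Λ∕a)} = M_K^{β∕(4+β)} at a = L^{−β}, Λ = L⁴: summable for shift_k = O(k^{−p}) only when p·β∕(4+β) > 1, i.e.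
p > (4+β)∕β, NOT p > 1»; (d4)(3): «under (α′) … threshold p > 1; under (β) the threshold is p > (4+β)∕β».

WHAT IS PROVED (all [folklore]; `σ := log(1∕a)∕log(Λ∕a)` = `T4Crossover`'s crossover exponent at `θ = 1`; `x* := log(1∕M)∕log(Λ∕a)`
the real crossover index, `n₀ := ⌈x*⌉₊`).  §1 BALANCE `a^{x*} = M·Λ^{x*} = M^σ`.  §2 LOWER BOUND: for `0 < a < 1`, `a < Λ`,
`0 < M ≤ 1`, `n₀ < N`: `a·M^σ ≤ Σ_{n<N} min(a^n, M·Λ^n)` (`crossSum_ge`; n-weighted shape `crossSumW_ge` for `M < 1`).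
§3 UPPER BOUND: for `0 < a < 1 < Λ`, `0 < M ≤ 1`, all `N`: `Σ_{n<N} min(a^n, M·Λ^n) ≤ (Λ∕(Λ−1) + 1∕(1−a))·M^σ` (`crossSum_le`)
— the surrogate is of order EXACTLY `M^σ`.  §4 THRESHOLD at `M_K := c·(K+1)^{−p}` (`0 < c ≤ 1`, `p > 0`), summing over the
`K+1` remaining-scale counts `n ≤ K`: **NOT summable when `p·σ ≤ 1`** (`not_summable_crossSum`, `not_summable_crossSumW`;
`x*(K) = O(log K) ≤ K` eventually, `crossIndex_le_of_large`), **summable when `p·σ > 1`**, `Λ > 1` (`summable_crossSum`).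
§5 at `a = L^{−β}`, `Λ = L⁴` (`L > 1`, `β > 0`): `σ = β∕(4+β)` (`crossExp_L`) and «summable iff `p > (4+β)∕β`»
(`crossSum_L_dichotomy`) — the writer's number, two-sided, in the kernel.
WHAT THIS DOES NOT DO.  It does not decide between readings (α′) and (β) of Q43 (c) (§1 D6's re-evaluation clause, a displayed
U3∕NE5-type hypothesis), re-types no END, moves no label, leaves NE4's interface of record (geometric `InjectedRate`) untouched;
under (α′) the tree's `CauchySumSummableShift` ∕ `CauchySumPinnedConvolution` give `Summable δ` for every summable shift
(`p > 1`); here, ON THE (β) SURROGATE, every `1 < p ≤ (4+β)∕β` FAILS — each threshold of (d4)(3) is sharp for its reading.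
Mathlib + `T4Crossover` import only; no definitions; no importer changes.  INTENT `CLAIMS.log` l.21824, dagwriter GO l.21896,
NE7b owner word l.21895 (NE7b formalise leaf-08 g15, idle-leaf volunteer slot of `T4-U6.R-QCALC2°`).
-/

namespace Summit.QuantumFields.BalabanUV.T4Continuum.CauchySumCrossoverThreshold

open Finset

/-! ## §1 Crossover exponent, crossover index, balance -/

/-- `0 < log(Λ∕a)` for `0 < a < Λ`. [folklore] -/
theorem log_ratio_pos {a Λ : ℝ} (ha0 : 0 < a) (haΛ : a < Λ) : 0 < Real.log (Λ / a) :=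
  Real.log_pos ((one_lt_div ha0).mpr haΛ)

/-- The crossover exponent `σ = log(1∕a)∕log(Λ∕a)` is positive for `0 < a < 1`, `a < Λ`. [folklore] -/
theorem crossExp_pos {a Λ : ℝ} (ha0 : 0 < a) (ha1 : a < 1) (haΛ : a < Λ) :
    0 < Real.log (1 / a) / Real.log (Λ / a) :=
  div_pos (Real.log_pos (one_lt_one_div ha0 ha1)) (log_ratio_pos ha0 haΛ)

/-- The real crossover index `x* = log(1∕M)∕log(Λ∕a)` is nonnegative for `0 < M ≤ 1` (`0 < a < Λ`). [folklore] -/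
theorem crossIndex_nonneg {a Λ M : ℝ} (ha0 : 0 < a) (haΛ : a < Λ) (hM0 : 0 < M) (hM1 : M ≤ 1) :
    0 ≤ Real.log (1 / M) / Real.log (Λ / a) :=
  div_nonneg (Real.log_nonneg (one_le_one_div hM0 hM1)) (log_ratio_pos ha0 haΛ).le

/-- … and positive for `0 < M < 1`. [folklore] -/
theorem crossIndex_pos {a Λ M : ℝ} (ha0 : 0 < a) (haΛ : a < Λ) (hM0 : 0 < M) (hM1 : M < 1) :
    0 < Real.log (1 / M) / Real.log (Λ / a) :=
  div_pos (Real.log_pos (one_lt_one_div hM0 hM1)) (log_ratio_pos ha0 haΛ)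

/-- **BALANCE (i)**: at the real crossover index the contraction branch equals `M^σ`:
`a^{x*} = M^σ`, `x* = log(1∕M)∕log(Λ∕a)`, `σ = log(1∕a)∕log(Λ∕a)` (`0 < a < Λ`, `0 < M`). [folklore] -/
theorem rpow_crossIndex_eq {a Λ M : ℝ} (ha0 : 0 < a) (haΛ : a < Λ) (hM : 0 < M) :
    a ^ (Real.log (1 / M) / Real.log (Λ / a)) = M ^ (Real.log (1 / a) / Real.log (Λ / a)) := by
  have hL : Real.log (Λ / a) ≠ 0 := (log_ratio_pos ha0 haΛ).ne'
  have hlhs : 0 < a ^ (Real.log (1 / M) / Real.log (Λ / a)) := Real.rpow_pos_of_pos ha0 _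
  have hrhs : 0 < M ^ (Real.log (1 / a) / Real.log (Λ / a)) := Real.rpow_pos_of_pos hM _
  refine Real.log_injOn_pos (Set.mem_Ioi.mpr hlhs) (Set.mem_Ioi.mpr hrhs) ?_
  rw [Real.log_rpow ha0, Real.log_rpow hM, one_div, Real.log_inv, one_div, Real.log_inv]
  field_simp

/-- **BALANCE (ii)**: at the real crossover index the growth branch equals `M^σ` too: `M·Λ^{x*} = M^σ`
(`0 < a < Λ`, `0 < M`). [folklore] -/
theorem mul_rpow_crossIndex_eq {a Λ M : ℝ} (ha0 : 0 < a) (haΛ : a < Λ) (hM : 0 < M) :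
    M * Λ ^ (Real.log (1 / M) / Real.log (Λ / a)) = M ^ (Real.log (1 / a) / Real.log (Λ / a)) := by
  have hΛ : 0 < Λ := ha0.trans haΛ
  have hL : Real.log (Λ / a) ≠ 0 := (log_ratio_pos ha0 haΛ).ne'
  have hdiv : Real.log (Λ / a) = Real.log Λ - Real.log a := Real.log_div hΛ.ne' ha0.ne'
  have hlhs : 0 < M * Λ ^ (Real.log (1 / M) / Real.log (Λ / a)) := mul_pos hM (Real.rpow_pos_of_pos hΛ _)
  have hrhs : 0 < M ^ (Real.log (1 / a) / Real.log (Λ / a)) := Real.rpow_pos_of_pos hM _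
  refine Real.log_injOn_pos (Set.mem_Ioi.mpr hlhs) (Set.mem_Ioi.mpr hrhs) ?_
  rw [Real.log_mul hM.ne' (Real.rpow_pos_of_pos hΛ _).ne', Real.log_rpow hΛ, Real.log_rpow hM, one_div,
    Real.log_inv, one_div, Real.log_inv, hdiv]
  rw [hdiv] at hL
  field_simp
  ring

/-! ## §2 Lower bound: the single crossover term pays `a·M^σ` -/

/-- At the integer crossover index `n₀ = ⌈x*⌉₊` the growth branch has caught up with the contraction branch:
`a^{n₀} ≤ M·Λ^{n₀}` (`0 < a < Λ`, `0 < M`). [folklore] -/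
theorem pow_ceil_le_mul_pow {a Λ M : ℝ} (ha0 : 0 < a) (haΛ : a < Λ) (hM : 0 < M) :
    a ^ ⌈Real.log (1 / M) / Real.log (Λ / a)⌉₊ ≤ M * Λ ^ ⌈Real.log (1 / M) / Real.log (Λ / a)⌉₊ := by
  have hΛ : 0 < Λ := ha0.trans haΛ
  set n₀ := ⌈Real.log (1 / M) / Real.log (Λ / a)⌉₊ with hn₀
  have hceil : Real.log (1 / M) / Real.log (Λ / a) ≤ n₀ := Nat.le_ceil _
  have h1 : Real.log (1 / M) ≤ (n₀ : ℝ) * Real.log (Λ / a) := by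
    rwa [div_le_iff₀ (log_ratio_pos ha0 haΛ)] at hceil
  rw [one_div, Real.log_inv, Real.log_div hΛ.ne' ha0.ne', mul_sub] at h1
  rw [← Real.log_le_log_iff (pow_pos ha0 _) (mul_pos hM (pow_pos hΛ _)), Real.log_pow,
    Real.log_mul hM.ne' (pow_pos hΛ _).ne', Real.log_pow]
  linarith

/-- The crossover term pays `a·M^σ`: `a·M^σ ≤ a^{n₀}` (`0 < a < 1`, `a < Λ`, `0 < M ≤ 1`; since `n₀ ≤ x* + 1` and
`a^{x*} = M^σ`). [folklore] -/
theorem mul_rpow_le_pow_ceil {a Λ M : ℝ} (ha0 : 0 < a) (ha1 : a < 1) (haΛ : a < Λ) (hM0 : 0 < M) (hM1 : M ≤ 1) :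
    a * M ^ (Real.log (1 / a) / Real.log (Λ / a)) ≤ a ^ ⌈Real.log (1 / M) / Real.log (Λ / a)⌉₊ := by
  set x := Real.log (1 / M) / Real.log (Λ / a) with hx
  have hx0 : 0 ≤ x := crossIndex_nonneg ha0 haΛ hM0 hM1
  have hceil : (⌈x⌉₊ : ℝ) ≤ x + 1 := (Nat.ceil_lt_add_one hx0).le
  calc a * M ^ (Real.log (1 / a) / Real.log (Λ / a)) = a ^ (x + 1) := by
        rw [Real.rpow_add ha0, Real.rpow_one, ← rpow_crossIndex_eq ha0 haΛ hM0, mul_comm]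
    _ ≤ a ^ (⌈x⌉₊ : ℝ) := Real.rpow_le_rpow_of_exponent_ge ha0 ha1.le hceil
    _ = a ^ ⌈x⌉₊ := Real.rpow_natCast a ⌈x⌉₊

/-- **LOWER BOUND** on the (β)-surrogate: for `0 < a < 1`, `a < Λ`, `0 < M ≤ 1` and `n₀ < N`,
`a·M^σ ≤ Σ_{n<N} min(a^n, M·Λ^n)`. [folklore] -/
theorem crossSum_ge {a Λ M : ℝ} {N : ℕ} (ha0 : 0 < a) (ha1 : a < 1) (haΛ : a < Λ) (hM0 : 0 < M) (hM1 : M ≤ 1)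
    (hN : ⌈Real.log (1 / M) / Real.log (Λ / a)⌉₊ < N) :
    a * M ^ (Real.log (1 / a) / Real.log (Λ / a)) ≤ ∑ n ∈ range N, min (a ^ n) (M * Λ ^ n) := by
  have hΛ : 0 ≤ Λ := (ha0.trans haΛ).le
  set n₀ := ⌈Real.log (1 / M) / Real.log (Λ / a)⌉₊ with hn₀
  calc a * M ^ (Real.log (1 / a) / Real.log (Λ / a)) ≤ a ^ n₀ := mul_rpow_le_pow_ceil ha0 ha1 haΛ hM0 hM1
    _ = min (a ^ n₀) (M * Λ ^ n₀) := (min_eq_left (pow_ceil_le_mul_pow ha0 haΛ hM0)).symm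
    _ ≤ ∑ n ∈ range N, min (a ^ n) (M * Λ ^ n) :=
        Finset.single_le_sum (f := fun n : ℕ => min (a ^ n) (M * Λ ^ n))
          (fun n _ => le_min (pow_nonneg ha0.le _) (mul_nonneg hM0.le (pow_nonneg hΛ _))) (mem_range.mpr hN)

/-- **LOWER BOUND, n-weighted shape** (the writer's `Σ_n min(a^n, n·M·Λ^n)`): for `0 < a < 1`, `a < Λ`, `0 < M < 1`
(so that `n₀ ≥ 1`) and `n₀ < N`, `a·M^σ ≤ Σ_{n<N} min(a^n, n·M·Λ^n)`. [folklore] -/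
theorem crossSumW_ge {a Λ M : ℝ} {N : ℕ} (ha0 : 0 < a) (ha1 : a < 1) (haΛ : a < Λ) (hM0 : 0 < M) (hM1 : M < 1)
    (hN : ⌈Real.log (1 / M) / Real.log (Λ / a)⌉₊ < N) :
    a * M ^ (Real.log (1 / a) / Real.log (Λ / a)) ≤ ∑ n ∈ range N, min (a ^ n) ((n : ℝ) * M * Λ ^ n) := by
  have hΛ : 0 ≤ Λ := (ha0.trans haΛ).le
  set n₀ := ⌈Real.log (1 / M) / Real.log (Λ / a)⌉₊ with hn₀
  have hn₀1 : (1 : ℝ) ≤ n₀ := by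
    have : 0 < n₀ := Nat.ceil_pos.mpr (crossIndex_pos ha0 haΛ hM0 hM1)
    exact_mod_cast this
  have hw : M * Λ ^ n₀ ≤ (n₀ : ℝ) * M * Λ ^ n₀ := by
    rw [mul_assoc]
    exact le_mul_of_one_le_left (mul_nonneg hM0.le (pow_nonneg hΛ _)) hn₀1
  calc a * M ^ (Real.log (1 / a) / Real.log (Λ / a)) ≤ a ^ n₀ := mul_rpow_le_pow_ceil ha0 ha1 haΛ hM0 hM1.le
    _ = min (a ^ n₀) ((n₀ : ℝ) * M * Λ ^ n₀) :=
        (min_eq_left ((pow_ceil_le_mul_pow ha0 haΛ hM0).trans hw)).symm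
    _ ≤ ∑ n ∈ range N, min (a ^ n) ((n : ℝ) * M * Λ ^ n) :=
        Finset.single_le_sum (f := fun n : ℕ => min (a ^ n) ((n : ℝ) * M * Λ ^ n))
          (fun n _ => le_min (pow_nonneg ha0.le _)
            (mul_nonneg (mul_nonneg (Nat.cast_nonneg n) hM0.le) (pow_nonneg hΛ _))) (mem_range.mpr hN)

/-! ## §3 Upper bound: the surrogate is of order exactly `M^σ` -/

/-- **UPPER BOUND** on the (β)-surrogate: for `0 < a < 1 < Λ`, `0 < M ≤ 1` and every `N`,
`Σ_{n<N} min(a^n, M·Λ^n) ≤ (Λ∕(Λ−1) + 1∕(1−a))·M^σ` (growth branch below `n₀`, contraction branch from `n₀` on; two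
geometric series evaluated at the crossover). [folklore] -/
theorem crossSum_le {a Λ M : ℝ} (ha0 : 0 < a) (ha1 : a < 1) (hΛ1 : 1 < Λ) (hM0 : 0 < M) (hM1 : M ≤ 1) (N : ℕ) :
    ∑ n ∈ range N, min (a ^ n) (M * Λ ^ n)
      ≤ (Λ / (Λ - 1) + 1 / (1 - a)) * M ^ (Real.log (1 / a) / Real.log (Λ / a)) := by
  have haΛ : a < Λ := ha1.trans hΛ1
  have hΛ0 : 0 < Λ := ha0.trans haΛ
  set x := Real.log (1 / M) / Real.log (Λ / a) with hx
  set σ := Real.log (1 / a) / Real.log (Λ / a) with hσ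
  set n₀ := ⌈x⌉₊ with hn₀
  have hx0 : 0 ≤ x := crossIndex_nonneg ha0 haΛ hM0 hM1
  have hxn : x ≤ n₀ := Nat.le_ceil x
  have hnx : (n₀ : ℝ) ≤ x + 1 := (Nat.ceil_lt_add_one hx0).le
  -- growth branch below the crossover
  have hA : ∑ n ∈ (range N).filter (fun n => n < n₀), min (a ^ n) (M * Λ ^ n) ≤ M * Λ ^ n₀ / (Λ - 1) := by
    calc ∑ n ∈ (range N).filter (fun n => n < n₀), min (a ^ n) (M * Λ ^ n)
        ≤ ∑ n ∈ (range N).filter (fun n => n < n₀), M * Λ ^ n := sum_le_sum fun n _ => min_le_right _ _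
      _ ≤ ∑ n ∈ range n₀, M * Λ ^ n := by
          refine sum_le_sum_of_subset_of_nonneg ?_ (fun n _ _ => mul_nonneg hM0.le (pow_nonneg hΛ0.le _))
          intro n hn
          simp only [mem_filter, mem_range] at hn ⊢
          exact hn.2
      _ = M * ((Λ ^ n₀ - 1) / (Λ - 1)) := by rw [← mul_sum, geom_sum_eq hΛ1.ne']
      _ ≤ M * (Λ ^ n₀ / (Λ - 1)) := by
          refine mul_le_mul_of_nonneg_left (div_le_div_of_nonneg_right (by linarith) (by linarith)) hM0.le
      _ = M * Λ ^ n₀ / (Λ - 1) := by ring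
  -- contraction branch from the crossover on
  have hB : ∑ n ∈ (range N).filter (fun n => ¬ n < n₀), min (a ^ n) (M * Λ ^ n) ≤ a ^ n₀ / (1 - a) := by
    calc ∑ n ∈ (range N).filter (fun n => ¬ n < n₀), min (a ^ n) (M * Λ ^ n)
        ≤ ∑ n ∈ (range N).filter (fun n => ¬ n < n₀), a ^ n := sum_le_sum fun n _ => min_le_left _ _
      _ ≤ ∑ n ∈ Ico n₀ (n₀ + N), a ^ n := by
          refine sum_le_sum_of_subset_of_nonneg ?_ (fun n _ _ => pow_nonneg ha0.le _)
          intro n hn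
          simp only [mem_filter, mem_range, not_lt] at hn
          simp only [mem_Ico]
          omega
      _ ≤ a ^ n₀ / (1 - a) := geom_sum_Ico_le_of_lt_one ha0.le ha1
  -- the two branches at the crossover are both of order M^σ
  have hA' : M * Λ ^ n₀ ≤ Λ * M ^ σ := by
    calc M * Λ ^ n₀ = M * Λ ^ (n₀ : ℝ) := by rw [Real.rpow_natCast]
      _ ≤ M * Λ ^ (x + 1) :=
          mul_le_mul_of_nonneg_left (Real.rpow_le_rpow_of_exponent_le hΛ1.le hnx) hM0.le
      _ = Λ * (M * Λ ^ x) := by rw [Real.rpow_add hΛ0, Real.rpow_one]; ring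
      _ = Λ * M ^ σ := by rw [mul_rpow_crossIndex_eq ha0 haΛ hM0]
  have hB' : a ^ n₀ ≤ M ^ σ := by
    calc a ^ n₀ = a ^ (n₀ : ℝ) := (Real.rpow_natCast a n₀).symm
      _ ≤ a ^ x := Real.rpow_le_rpow_of_exponent_ge ha0 ha1.le hxn
      _ = M ^ σ := rpow_crossIndex_eq ha0 haΛ hM0
  have hΛm : 0 < Λ - 1 := by linarith
  have ham : 0 < 1 - a := by linarith
  rw [← Finset.sum_filter_add_sum_filter_not (range N) (fun n => n < n₀)]
  calc ∑ n ∈ (range N).filter (fun n => n < n₀), min (a ^ n) (M * Λ ^ n)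
        + ∑ n ∈ (range N).filter (fun n => ¬ n < n₀), min (a ^ n) (M * Λ ^ n)
        ≤ M * Λ ^ n₀ / (Λ - 1) + a ^ n₀ / (1 - a) := add_le_add hA hB
    _ ≤ Λ * M ^ σ / (Λ - 1) + M ^ σ / (1 - a) :=
        add_le_add (div_le_div_of_nonneg_right hA' hΛm.le) (div_le_div_of_nonneg_right hB' ham.le)
    _ = (Λ / (Λ - 1) + 1 / (1 - a)) * M ^ σ := by ring

/-! ## §4 The summability threshold `p·σ > 1` at `M_K = c·(K+1)^{−p}` -/

/-- The crossover index of `M_K = c·(K+1)^{−p}` is `x*(K) = (log(1∕c) + p·log(K+1))∕log(Λ∕a) = O(log K)`, hence `≤ K`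
for large `K` — explicitly as soon as `(A + 2B + 1)² ≤ K + 1`, `A = log(1∕c)∕log(Λ∕a)`, `B = p∕log(Λ∕a)`
(via `log(K+1) ≤ 2√(K+1)`). [folklore] -/
theorem crossIndex_le_of_large {a Λ c p : ℝ} (ha0 : 0 < a) (haΛ : a < Λ) (hc0 : 0 < c) (hc1 : c ≤ 1) (hp : 0 ≤ p)
    {K : ℕ} (hK : (Real.log (1 / c) / Real.log (Λ / a) + 2 * (p / Real.log (Λ / a)) + 1) ^ 2 ≤ (K : ℝ) + 1) :
    Real.log (1 / (c * ((K : ℝ) + 1) ^ (-p))) / Real.log (Λ / a) ≤ K := by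
  have hD : 0 < Real.log (Λ / a) := log_ratio_pos ha0 haΛ
  set A := Real.log (1 / c) / Real.log (Λ / a) with hA_def
  set B := p / Real.log (Λ / a) with hB_def
  have hA : 0 ≤ A := div_nonneg (Real.log_nonneg (one_le_one_div hc0 hc1)) hD.le
  have hB : 0 ≤ B := div_nonneg hp hD.le
  have hK1 : 0 < (K : ℝ) + 1 := by positivity
  have hx : Real.log (1 / (c * ((K : ℝ) + 1) ^ (-p))) / Real.log (Λ / a) = A + B * Real.log ((K : ℝ) + 1) := by
    rw [one_div, Real.log_inv, Real.log_mul hc0.ne' (Real.rpow_pos_of_pos hK1 _).ne', Real.log_rpow hK1, hA_def,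
      hB_def, one_div, Real.log_inv]
    field_simp
    ring
  set s := Real.sqrt ((K : ℝ) + 1) with hs_def
  have hlog : Real.log ((K : ℝ) + 1) ≤ 2 * s := by
    have h := Real.log_le_rpow_div hK1.le (by norm_num : (0 : ℝ) < 1 / 2)
    rw [hs_def, Real.sqrt_eq_rpow]
    linarith
  have hs1 : 1 ≤ s := by
    have h : Real.sqrt 1 ≤ s := Real.sqrt_le_sqrt (by linarith [(Nat.cast_nonneg K : (0 : ℝ) ≤ K)])
    rwa [Real.sqrt_one] at h
  have hTs : A + 2 * B + 1 ≤ s := by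
    have h : Real.sqrt ((A + 2 * B + 1) ^ 2) ≤ s := Real.sqrt_le_sqrt hK
    rwa [Real.sqrt_sq (by linarith)] at h
  have hss : s * s = (K : ℝ) + 1 := by rw [← sq, hs_def, Real.sq_sqrt hK1.le]
  have h1 : (A + 2 * B + 1) * s ≤ s * s := mul_le_mul_of_nonneg_right hTs (by linarith)
  have h3 : A ≤ A * s := le_mul_of_one_le_right hA hs1
  have hBl : B * Real.log ((K : ℝ) + 1) ≤ B * (2 * s) := mul_le_mul_of_nonneg_left hlog hB
  rw [hx]
  nlinarith

/-- The scale-shift size `M_K = c·(K+1)^{−p}` lies in `]0, 1]` (`0 < c ≤ 1`, `p ≥ 0`). [folklore] -/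
theorem shiftSize_pos_le_one {c p : ℝ} (hc0 : 0 < c) (hc1 : c ≤ 1) (hp : 0 ≤ p) (K : ℕ) :
    0 < c * ((K : ℝ) + 1) ^ (-p) ∧ c * ((K : ℝ) + 1) ^ (-p) ≤ 1 := by
  have hK1 : (1 : ℝ) ≤ (K : ℝ) + 1 := by linarith [(Nat.cast_nonneg K : (0 : ℝ) ≤ K)]
  refine ⟨mul_pos hc0 (Real.rpow_pos_of_pos (by linarith) _), ?_⟩
  have h1 : ((K : ℝ) + 1) ^ (-p) ≤ 1 := Real.rpow_le_one_of_one_le_of_nonpos hK1 (by linarith)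
  nlinarith [Real.rpow_nonneg (by linarith : (0 : ℝ) ≤ (K : ℝ) + 1) (-p)]

/-- … and strictly below `1` once `K ≥ 1` and `p > 0`. [folklore] -/
theorem shiftSize_lt_one {c p : ℝ} (hc1 : c ≤ 1) (hp : 0 < p) {K : ℕ} (hK : 1 ≤ K) :
    c * ((K : ℝ) + 1) ^ (-p) < 1 := by
  have hK1 : (1 : ℝ) < (K : ℝ) + 1 := by
    have : (1 : ℝ) ≤ K := by exact_mod_cast hK
    linarith
  calc c * ((K : ℝ) + 1) ^ (-p) ≤ 1 * ((K : ℝ) + 1) ^ (-p) :=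
        mul_le_mul_of_nonneg_right hc1 (Real.rpow_nonneg (by linarith) _)
    _ < 1 := by rw [one_mul]; exact Real.rpow_lt_one_of_one_lt_of_neg hK1 (by linarith)

/-- `M_K^σ = c^σ·(K+1)^{−pσ}`. [folklore] -/
theorem shiftSize_rpow {c p σ : ℝ} (hc0 : 0 ≤ c) (K : ℕ) :
    (c * ((K : ℝ) + 1) ^ (-p)) ^ σ = c ^ σ * ((K : ℝ) + 1) ^ (-(p * σ)) := by
  have hK : (0 : ℝ) ≤ (K : ℝ) + 1 := by positivity
  rw [Real.mul_rpow hc0 (Real.rpow_nonneg hK _), ← Real.rpow_mul hK, neg_mul]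

/-- The shifted p-series: `K ↦ (K+1)^{−q}` is summable iff `1 < q`. [folklore] -/
theorem summable_succ_rpow_neg_iff {q : ℝ} : Summable (fun K : ℕ => ((K : ℝ) + 1) ^ (-q)) ↔ 1 < q := by
  have h := (summable_nat_add_iff (f := fun n : ℕ => (n : ℝ) ^ (-q)) 1)
  simp only [Nat.cast_add, Nat.cast_one] at h
  rw [h, Real.summable_nat_rpow]
  constructor <;> intro hq <;> linarith

/-- **THE (β)-SURROGATE IS NOT SUMMABLE WHEN `p·σ ≤ 1`.**  For `0 < a < 1`, `a < Λ`, `0 < c ≤ 1`, `0 < p` and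
`p·σ ≤ 1`, `σ = log(1∕a)∕log(Λ∕a)`, the sequence `K ↦ Σ_{n≤K} min(a^n, c(K+1)^{−p}·Λ^n)` is NOT summable
(eventually `≥ a·c^σ·(K+1)^{−pσ}`, a divergent p-series). [folklore] -/
theorem not_summable_crossSum {a Λ c p : ℝ} (ha0 : 0 < a) (ha1 : a < 1) (haΛ : a < Λ) (hc0 : 0 < c) (hc1 : c ≤ 1)
    (hp : 0 < p) (hpσ : p * (Real.log (1 / a) / Real.log (Λ / a)) ≤ 1) :
    ¬ Summable (fun K : ℕ => ∑ n ∈ range (K + 1), min (a ^ n) (c * ((K : ℝ) + 1) ^ (-p) * Λ ^ n)) := by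
  set σ := Real.log (1 / a) / Real.log (Λ / a) with hσ
  intro hS
  set T := (Real.log (1 / c) / Real.log (Λ / a) + 2 * (p / Real.log (Λ / a)) + 1) ^ 2 with hT
  have hev : ∀ K : ℕ, ⌈T⌉₊ ≤ K → a * c ^ σ * ((K : ℝ) + 1) ^ (-(p * σ))
      ≤ ∑ n ∈ range (K + 1), min (a ^ n) (c * ((K : ℝ) + 1) ^ (-p) * Λ ^ n) := by
    intro K hK
    have hK' : T ≤ (K : ℝ) + 1 := (Nat.ceil_le.mp hK).trans (by linarith)
    have hidx := crossIndex_le_of_large ha0 haΛ hc0 hc1 hp.le hK'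
    have hN : ⌈Real.log (1 / (c * ((K : ℝ) + 1) ^ (-p))) / Real.log (Λ / a)⌉₊ < K + 1 :=
      Nat.lt_succ_of_le (Nat.ceil_le.mpr hidx)
    have h := crossSum_ge ha0 ha1 haΛ (shiftSize_pos_le_one hc0 hc1 hp.le K).1
      (shiftSize_pos_le_one hc0 hc1 hp.le K).2 hN
    rwa [shiftSize_rpow hc0.le K, ← mul_assoc] at h
  have hf : Summable (fun K : ℕ => a * c ^ σ * ((K : ℝ) + 1) ^ (-(p * σ))) := by
    refine Summable.of_norm_bounded_eventually_nat hS ?_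
    filter_upwards [Filter.eventually_ge_atTop ⌈T⌉₊] with K hK
    rw [Real.norm_of_nonneg (by positivity)]
    exact hev K hK
  have hac : a * c ^ σ ≠ 0 := (mul_pos ha0 (Real.rpow_pos_of_pos hc0 _)).ne'
  have hg : Summable (fun K : ℕ => ((K : ℝ) + 1) ^ (-(p * σ))) := (summable_mul_left_iff hac).mp hf
  have := summable_succ_rpow_neg_iff.mp hg
  linarith

/-- **NOT SUMMABLE, n-weighted shape** (the writer's `Σ_n min(a^n, n·M_K·Λ^n)`): same hypotheses, same conclusion.
[folklore] -/
theorem not_summable_crossSumW {a Λ c p : ℝ} (ha0 : 0 < a) (ha1 : a < 1) (haΛ : a < Λ) (hc0 : 0 < c) (hc1 : c ≤ 1)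
    (hp : 0 < p) (hpσ : p * (Real.log (1 / a) / Real.log (Λ / a)) ≤ 1) :
    ¬ Summable (fun K : ℕ => ∑ n ∈ range (K + 1),
      min (a ^ n) ((n : ℝ) * (c * ((K : ℝ) + 1) ^ (-p)) * Λ ^ n)) := by
  set σ := Real.log (1 / a) / Real.log (Λ / a) with hσ
  intro hS
  set T := (Real.log (1 / c) / Real.log (Λ / a) + 2 * (p / Real.log (Λ / a)) + 1) ^ 2 with hT
  have hev : ∀ K : ℕ, max ⌈T⌉₊ 1 ≤ K → a * c ^ σ * ((K : ℝ) + 1) ^ (-(p * σ))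
      ≤ ∑ n ∈ range (K + 1), min (a ^ n) ((n : ℝ) * (c * ((K : ℝ) + 1) ^ (-p)) * Λ ^ n) := by
    intro K hK
    have hK' : T ≤ (K : ℝ) + 1 := (Nat.ceil_le.mp (le_of_max_le_left hK)).trans (by linarith)
    have hidx := crossIndex_le_of_large ha0 haΛ hc0 hc1 hp.le hK'
    have hN : ⌈Real.log (1 / (c * ((K : ℝ) + 1) ^ (-p))) / Real.log (Λ / a)⌉₊ < K + 1 :=
      Nat.lt_succ_of_le (Nat.ceil_le.mpr hidx)
    have h := crossSumW_ge ha0 ha1 haΛ (shiftSize_pos_le_one hc0 hc1 hp.le K).1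
      (shiftSize_lt_one hc1 hp (le_of_max_le_right hK)) hN
    rwa [shiftSize_rpow hc0.le K, ← mul_assoc] at h
  have hf : Summable (fun K : ℕ => a * c ^ σ * ((K : ℝ) + 1) ^ (-(p * σ))) := by
    refine Summable.of_norm_bounded_eventually_nat hS ?_
    filter_upwards [Filter.eventually_ge_atTop (max ⌈T⌉₊ 1)] with K hK
    rw [Real.norm_of_nonneg (by positivity)]
    exact hev K hK
  have hac : a * c ^ σ ≠ 0 := (mul_pos ha0 (Real.rpow_pos_of_pos hc0 _)).ne'
  have hg : Summable (fun K : ℕ => ((K : ℝ) + 1) ^ (-(p * σ))) := (summable_mul_left_iff hac).mp hf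
  have := summable_succ_rpow_neg_iff.mp hg
  linarith

/-- **THE (β)-SURROGATE IS SUMMABLE WHEN `p·σ > 1`** (and `Λ > 1`): for `0 < a < 1 < Λ`, `0 < c ≤ 1`, `0 < p`,
`1 < p·σ`, the sequence `K ↦ Σ_{n≤K} min(a^n, c(K+1)^{−p}·Λ^n)` is summable
(`≤ (Λ∕(Λ−1) + 1∕(1−a))·c^σ·(K+1)^{−pσ}`, a convergent p-series). [folklore] -/
theorem summable_crossSum {a Λ c p : ℝ} (ha0 : 0 < a) (ha1 : a < 1) (hΛ1 : 1 < Λ) (hc0 : 0 < c) (hc1 : c ≤ 1)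
    (hp : 0 < p) (hpσ : 1 < p * (Real.log (1 / a) / Real.log (Λ / a))) :
    Summable (fun K : ℕ => ∑ n ∈ range (K + 1), min (a ^ n) (c * ((K : ℝ) + 1) ^ (-p) * Λ ^ n)) := by
  set σ := Real.log (1 / a) / Real.log (Λ / a) with hσ
  have hΛ0 : 0 ≤ Λ := by linarith
  have hmaj : Summable (fun K : ℕ => (Λ / (Λ - 1) + 1 / (1 - a)) * (c ^ σ * ((K : ℝ) + 1) ^ (-(p * σ)))) :=
    ((summable_succ_rpow_neg_iff.mpr hpσ).mul_left _).mul_left _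
  refine Summable.of_nonneg_of_le (fun K => sum_nonneg fun n _ => ?_) (fun K => ?_) hmaj
  · exact le_min (pow_nonneg ha0.le _)
      (mul_nonneg (shiftSize_pos_le_one hc0 hc1 hp.le K).1.le (pow_nonneg hΛ0 _))
  · obtain ⟨hM0, hM1⟩ := shiftSize_pos_le_one hc0 hc1 hp.le K
    have h := crossSum_le ha0 ha1 hΛ1 hM0 hM1 (K + 1)
    rwa [shiftSize_rpow hc0.le K] at h

/-! ## §5 The writer's numbers: `a = L^{−β}`, `Λ = L⁴` -/

/-- At `a = L^{−β}`, `Λ = L⁴` (`L > 1`, `β > 0`) the crossover exponent is `σ = β∕(4+β)`. [folklore] -/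
theorem crossExp_L {L β : ℝ} (hL : 1 < L) (hβ : 0 < β) :
    Real.log (1 / L ^ (-β)) / Real.log (L ^ (4 : ℝ) / L ^ (-β)) = β / (4 + β) := by
  have hL0 : 0 < L := by linarith
  have hlogL : 0 < Real.log L := Real.log_pos hL
  rw [one_div, ← Real.rpow_neg hL0.le, neg_neg, ← Real.rpow_sub hL0, Real.log_rpow hL0, Real.log_rpow hL0]
  have h4 : (4 : ℝ) - -β = 4 + β := by ring
  rw [h4]
  field_simp

/-- **THE DICHOTOMY IN THE WRITER'S NUMBERS.**  At `a = L^{−β}`, `Λ = L⁴` (`L > 1`, `β > 0`), shift size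
`c·(K+1)^{−p}` (`0 < c ≤ 1`, `p > 0`): the (β)-surrogate `K ↦ Σ_{n≤K} min(L^{−βn}, c(K+1)^{−p} L^{4n})` is NOT summable
for `p ≤ (4+β)∕β` and IS summable for `p > (4+β)∕β` — «summable … only when p > (4+β)∕β, NOT p > 1» (T4-DAG §8 Q43 (c)),
two-sided. [folklore] -/
theorem crossSum_L_dichotomy {L β c p : ℝ} (hL : 1 < L) (hβ : 0 < β) (hc0 : 0 < c) (hc1 : c ≤ 1) (hp : 0 < p) :
    (p ≤ (4 + β) / β → ¬ Summable (fun K : ℕ => ∑ n ∈ range (K + 1),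
        min ((L ^ (-β)) ^ n) (c * ((K : ℝ) + 1) ^ (-p) * (L ^ (4 : ℝ)) ^ n))) ∧
    ((4 + β) / β < p → Summable (fun K : ℕ => ∑ n ∈ range (K + 1),
        min ((L ^ (-β)) ^ n) (c * ((K : ℝ) + 1) ^ (-p) * (L ^ (4 : ℝ)) ^ n))) := by
  have hL0 : 0 < L := by linarith
  have ha0 : 0 < L ^ (-β) := Real.rpow_pos_of_pos hL0 _
  have ha1 : L ^ (-β) < 1 := Real.rpow_lt_one_of_one_lt_of_neg hL (by linarith)
  have hΛ1 : 1 < L ^ (4 : ℝ) := Real.one_lt_rpow hL (by norm_num)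
  have haΛ : L ^ (-β) < L ^ (4 : ℝ) := ha1.trans hΛ1
  have hσ := crossExp_L hL hβ
  have h4 : (0 : ℝ) < 4 + β := by linarith
  refine ⟨fun hple => ?_, fun hlt => ?_⟩
  · refine not_summable_crossSum ha0 ha1 haΛ hc0 hc1 hp ?_
    rw [hσ]
    have h1 : p * β ≤ 4 + β := (le_div_iff₀ hβ).mp hple
    have e : p * (β / (4 + β)) = p * β / (4 + β) := by ring
    rw [e, div_le_one h4]
    exact h1
  · refine summable_crossSum ha0 ha1 hΛ1 hc0 hc1 hp ?_
    rw [hσ]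
    have h1 : 4 + β < p * β := (div_lt_iff₀ hβ).mp hlt
    have e : p * (β / (4 + β)) = p * β / (4 + β) := by ring
    rw [e, lt_div_iff₀ h4]
    linarith

end Summit.QuantumFields.BalabanUV.T4Continuum.CauchySumCrossoverThreshold
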